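import Mathlib
import Literature.MathematicalPhysics.QuantumFieldTheory.GaugeOSData
import Literature.MathematicalPhysics.QuantumLattice.WilsonBlockHeatBathLightCone2
import Summits.QuantumFields.YangMills.Theorems.ClusteringToYangMills.Negative.AdapterCover
import HarnessLib

/-!
# `ContinuumLegGivenGap` (stmt-QuantumFields-8782), line `Sketch` — stub `stub_compose`

The soft composition step of the torus-clause adapter of the crux
`Summit.QuantumFields.YangMills.Theses.ConvexGribovBody.ContinuumLegGivenGap`. From

1. the PAIR-TO-NORM upgrade (for a fixed pair of support boxes `Λ₁, Λ₂`, a family of torus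
   connected correlations that is `O(w)` pair by pair is `O(w)` in product form
   `K ‖A‖∞ ‖B‖∞`, one constant per box pair), and
2. β-UNIFORMITY ON BOUNDED COUPLING INTERVALS (above `β₁`, on every `[β₁, b]` one rate and
   per-pair constants uniform in `β`),

the ADAPTER follows: per-β volume-uniform torus clustering upgrades to β-FREE per-pair constants
with a rate function (hypothesis (1) of the hub stmt-QuantumFields-8762, threshold `S₀ ≡ 0`).

Proof. Cover the tail `[β₁, ∞)` by the pieces `X k = [β₁, β₁ + (k + 1)]`; enumerate the countably
many support-box pairs by `e : ℕ → _`; let `f j β S n` be the supremum of `|corr_{β,2S+1}(A, B; n)|`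
over the pairs `(A, B)` with supports `e j` and sup norms `≤ 1` (a priori `≤ 2`). Hypothesis 2 at
`b = β₁ + (k + 1)` and hypothesis 1 on the piece `X k` bound `f j` uniformly on `X k`; the sibling
crux's diagonal lemma `uniformShape_of_cover` then gives one rate function and `β`-free constants
`C_j`. Reading back to an arbitrary pair `(A, B)` is the bilinear rescaling
`corr(a A', b B') = a b · corr(A', B')` with `a = ‖A‖∞`, `b = ‖B‖∞`. [folklore]
-/

noncomputable section

namespace Summit.QuantumFields.YangMills.Theorems.ContinuumLegGivenGap

open Literature.MathematicalPhysics.QuantumFieldTheory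
open Literature.MathematicalPhysics.QuantumLattice (LGConfig torusLift configShift)
open Literature.MathematicalPhysics.QuantumLattice.WilsonBlockHeatBath
  (abs_latticeConnectedCorr_le_two_mul)
open Summit.QuantumFields.YangMills.Theorems.ClusteringToYangMills.Negative (uniformShape_of_cover)

/-- Connected torus correlations are bilinear: `corr(sA, tB) = st · corr(A, B)`. [folklore] -/
theorem latticeConnectedCorr_smul_smul {G : Type} [Group G] [TopologicalSpace G]
    [IsTopologicalGroup G] [CompactSpace G] [MeasurableSpace G] [BorelSpace G] {N : ℕ}
    (ρ : G →* Matrix (Fin N) (Fin N) ℂ) (β : ℝ) (S : ℕ) [NeZero S] (s t : ℝ)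
    (A B : LGConfig 4 G → ℝ) (n : ℕ) :
    latticeConnectedCorr ρ β S (fun U => s * A U) (fun U => t * B U) n =
      s * t * latticeConnectedCorr ρ β S A B n := by
  -- adapted from Summit.QuantumFields.YangMills.Theorems.LatticeGapInUVUnits.Negative.latticeConnectedCorr_smul
  unfold latticeConnectedCorr
  have h1 : (fun U : GaugeConfig 4 S G =>
      s * A (torusLift S U) * (t * B (configShift (-Pi.single 0 (n : ℤ)) (torusLift S U)))) =
      fun U => (s * t) *
        (A (torusLift S U) * B (configShift (-Pi.single 0 (n : ℤ)) (torusLift S U))) := by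
    funext U; ring
  rw [h1, MeasureTheory.integral_const_mul, MeasureTheory.integral_const_mul,
    MeasureTheory.integral_const_mul]
  ring

/-- Pointwise form of the bilinear rescaling: if `A = s A'` and `B = t B'` pointwise then
`corr(A, B) = st · corr(A', B')`. [folklore] -/
theorem latticeConnectedCorr_of_rescale {G : Type} [Group G] [TopologicalSpace G]
    [IsTopologicalGroup G] [CompactSpace G] [MeasurableSpace G] [BorelSpace G] {N : ℕ}
    (ρ : G →* Matrix (Fin N) (Fin N) ℂ) (β : ℝ) (S : ℕ) [NeZero S] {s t : ℝ}
    {A B A' B' : LGConfig 4 G → ℝ} (hA : ∀ U, A U = s * A' U) (hB : ∀ U, B U = t * B' U)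
    (n : ℕ) :
    latticeConnectedCorr ρ β S A B n = s * t * latticeConnectedCorr ρ β S A' B' n := by
  obtain rfl : A = fun U => s * A' U := funext hA
  obtain rfl : B = fun U => t * B' U := funext hB
  exact latticeConnectedCorr_smul_smul ρ β S s t A' B' n

/-- **Unit-ball normalisation of a local gauge-invariant observable**: every `A : YMSpecies G` is
`‖A‖∞ · A'` pointwise for an observable `A'` with the same support box and `‖A'‖∞ ≤ 1`
(`A' = ‖A‖∞⁻¹ A`; for `‖A‖∞ = 0` both sides vanish). [folklore] -/
theorem exists_unit_rescale {G : Type} [Group G] [MeasurableSpace G] (A : YMSpecies G) :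
    ∃ A' : YMSpecies G, A'.supp = A.supp ∧ (∀ U, |A'.F U| ≤ 1) ∧
      ∀ U, A.F U = (⨆ V, |A.F V|) * A'.F U := by
  have hbdd : BddAbove (Set.range fun V => |A.F V|) := by
    obtain ⟨C, hC⟩ := A.bounded
    exact ⟨C, by rintro _ ⟨V, rfl⟩; exact hC V⟩
  have hle : ∀ U, |A.F U| ≤ ⨆ V, |A.F V| := fun U => le_ciSup hbdd U
  have h0 : 0 ≤ ⨆ V, |A.F V| := Real.iSup_nonneg fun V => abs_nonneg _
  set a : ℝ := ⨆ V, |A.F V| with ha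
  have h1 : ∀ U, |a⁻¹ * A.F U| ≤ 1 := fun U => by
    rw [abs_mul, abs_inv, abs_of_nonneg h0]
    rcases eq_or_lt_of_le h0 with h | h
    · rw [← h, inv_zero, zero_mul]; exact zero_le_one
    · exact (inv_mul_le_one₀ h).2 (hle U)
  have h2 : ∀ U, A.F U = a * (a⁻¹ * A.F U) := fun U => by
    rcases eq_or_lt_of_le h0 with h | h
    · rw [← h, zero_mul]
      exact abs_nonpos_iff.1 ((hle U).trans_eq h.symm)
    · rw [mul_inv_cancel_left₀ h.ne']
  exact ⟨{ F := fun U => a⁻¹ * A.F U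
           supp := A.supp
           isCylinder := by
             intro U V hUV
             exact congrArg (fun x => a⁻¹ * x) (A.isCylinder hUV)
           gaugeInvariant := by
             intro g U
             exact congrArg (fun x => a⁻¹ * x) (A.gaugeInvariant g U)
           bounded := ⟨1, h1⟩
           measurable := A.measurable.const_mul _ }, rfl, h1, h2⟩

/-- **The adapter from the pair-to-norm upgrade and β-uniformity on bounded coupling intervals**
(`PairToNorm → UniformOnCompacts → Adapter` of line `Sketch`, unfolded): at every compact simple
`(G, r)` with per-β torus clustering above `β₀`, hypothesis 2 covers the tail `[β₁, ∞)` by the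
countably many bounded pieces `[β₁, β₁ + (k + 1)]` with a common rate and β-uniform per-pair
constants on each piece; hypothesis 1 makes these constants product-form `K ‖A‖∞ ‖B‖∞` per
support-box pair; the support-box pairs are countable, so the diagonal lemma
`uniformShape_of_cover` applied to the unit-ball suprema of the correlations yields one rate
function `m(β) > 0` and β-free constants, read back to arbitrary pairs by bilinear rescaling
(`S₀ ≡ 0`). [folklore] -/
theorem stub_compose :
    (∀ (G : Type) [Group G] [TopologicalSpace G] [IsTopologicalGroup G] [CompactSpace G]
      [MeasurableSpace G] [BorelSpace G] (r : LatticeRep G)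
      (Λ₁ Λ₂ : Finset (Literature.MathematicalPhysics.QuantumLattice.ZdEdge 4))
      (P : ℝ → ℕ → ℕ → Prop) (w : ℝ → ℕ → ℕ → ℝ), (∀ β S n, P β S n → 0 < w β S n) →
      (∀ A B : YMSpecies G, A.supp = Λ₁ → B.supp = Λ₂ → ∃ C : ℝ, ∀ β S n, P β S n →
          |latticeConnectedCorr r.ρ β (2 * S + 1) A.F B.F n| ≤ C * w β S n) →
        ∃ K : ℝ, ∀ A B : YMSpecies G, A.supp = Λ₁ → B.supp = Λ₂ → ∀ β S n, P β S n →
          |latticeConnectedCorr r.ρ β (2 * S + 1) A.F B.F n| ≤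
            K * (⨆ U, |A.F U|) * (⨆ U, |B.F U|) * w β S n) →
    (∀ (G : Type) [Group G] [TopologicalSpace G] [IsTopologicalGroup G] [CompactSpace G]
      [MeasurableSpace G] [BorelSpace G], IsCompactSimpleLieGroup G → ∀ r : LatticeRep G,
      (∃ β₀ : ℝ, ∀ β : ℝ, β₀ ≤ β → ∃ m : ℝ, 0 < m ∧ TorusClusteringAt r β m) →
        ∃ β₁ : ℝ, ∀ b : ℝ, ∃ μ : ℝ, 0 < μ ∧ ∀ A B : YMSpecies G, ∃ C : ℝ,
          ∀ β : ℝ, β₁ ≤ β → β ≤ b → ∀ S n : ℕ, n ≤ S →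
            |latticeConnectedCorr r.ρ β (2 * S + 1) A.F B.F n| ≤ C * Real.exp (-(μ * n))) →
    ∀ (G : Type) [Group G] [TopologicalSpace G] [IsTopologicalGroup G] [CompactSpace G]
      [MeasurableSpace G] [BorelSpace G], IsCompactSimpleLieGroup G → ∀ r : LatticeRep G,
      (∃ β₀ : ℝ, ∀ β : ℝ, β₀ ≤ β → ∃ m : ℝ, 0 < m ∧ TorusClusteringAt r β m) →
        ∃ (β₁ : ℝ) (m : ℝ → ℝ) (S₀ : ℝ → ℕ), (∀ β : ℝ, β₁ ≤ β → 0 < m β) ∧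
          ∀ A B : YMSpecies G, ∃ C : ℝ, ∀ β : ℝ, β₁ ≤ β → ∀ S n : ℕ, S₀ β ≤ S → n ≤ S →
            |latticeConnectedCorr r.ρ β (2 * S + 1) A.F B.F n| ≤ C * Real.exp (-(m β * n)) := by
  intro hPN hUC G _ _ _ _ _ _ hG r hH
  obtain ⟨β₁, hb⟩ := hUC G hG r hH
  -- enumerate the countably many support-box pairs
  obtain ⟨e, he⟩ := exists_surjective_nat
    (Finset (Literature.MathematicalPhysics.QuantumLattice.ZdEdge 4) ×
      Finset (Literature.MathematicalPhysics.QuantumLattice.ZdEdge 4))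
  -- the unit-ball suprema of the correlations over the box pair `e j`
  obtain ⟨f, hf⟩ : ∃ f : ℕ → ℝ → ℕ → ℕ → ℝ, ∀ j β S n, f j β S n =
      ⨆ p : {p : YMSpecies G × YMSpecies G // p.1.supp = (e j).1 ∧ p.2.supp = (e j).2 ∧
          (∀ U, |p.1.F U| ≤ 1) ∧ ∀ U, |p.2.F U| ≤ 1},
        |latticeConnectedCorr r.ρ β (2 * S + 1) p.1.1.F p.1.2.F n| :=
    ⟨_, fun _ _ _ _ => rfl⟩
  have hf0 : ∀ j β S n, 0 ≤ f j β S n := fun j β S n => by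
    rw [hf]; exact Real.iSup_nonneg fun p => abs_nonneg _
  -- a priori bound `f ≤ 2`
  have hf2 : ∀ j β S n, |f j β S n| ≤ 2 := fun j β S n => by
    rw [abs_of_nonneg (hf0 j β S n), hf]
    refine Real.iSup_le (fun p => ?_) zero_le_two
    have := abs_latticeConnectedCorr_le_two_mul r β (2 * S + 1) p.2.2.2.1 p.2.2.2.2 n
    linarith
  -- the countable cover of the tail by bounded coupling intervals
  have hcov : ∀ β : ℝ, β₁ ≤ β → ∃ k : ℕ, β ∈ Set.Icc β₁ (β₁ + ((k : ℝ) + 1)) := fun β hβ =>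
    ⟨⌊β - β₁⌋₊, Set.mem_Icc.2 ⟨hβ, by linarith [Nat.lt_floor_add_one (β - β₁)]⟩⟩
  -- on each piece: hypothesis 2 (common rate, per-pair constants), then hypothesis 1 (product form)
  have hunif : ∀ k : ℕ, ∃ μ : ℝ, 0 < μ ∧ ∀ j : ℕ, ∃ C : ℝ,
      ∀ β ∈ Set.Icc β₁ (β₁ + ((k : ℝ) + 1)), ∀ S n : ℕ, n ≤ S →
        |f j β S n| ≤ C * Real.exp (-(μ * n)) := by
    intro k
    obtain ⟨μ, hμ, hAB⟩ := hb (β₁ + ((k : ℝ) + 1))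
    refine ⟨μ, hμ, fun j => ?_⟩
    obtain ⟨K, hK⟩ := hPN G r (e j).1 (e j).2
      (fun β S n => β ∈ Set.Icc β₁ (β₁ + ((k : ℝ) + 1)) ∧ n ≤ S)
      (fun _ _ n => Real.exp (-(μ * n))) (fun _ _ _ _ => Real.exp_pos _)
      (fun A B _ _ => by
        obtain ⟨C, hC⟩ := hAB A B
        exact ⟨C, fun β S n hP =>
          hC β (Set.mem_Icc.1 hP.1).1 (Set.mem_Icc.1 hP.1).2 S n hP.2⟩)
    refine ⟨max K 0, fun β hβ S n hn => ?_⟩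
    rw [abs_of_nonneg (hf0 j β S n), hf]
    have hw : 0 ≤ Real.exp (-(μ * n)) := (Real.exp_pos _).le
    refine Real.iSup_le (fun p => ?_) (mul_nonneg (le_max_right _ _) hw)
    have ha0 : 0 ≤ ⨆ U, |p.1.1.F U| := Real.iSup_nonneg fun U => abs_nonneg _
    have hb0 : 0 ≤ ⨆ U, |p.1.2.F U| := Real.iSup_nonneg fun U => abs_nonneg _
    have ha1 : ⨆ U, |p.1.1.F U| ≤ 1 := Real.iSup_le p.2.2.2.1 zero_le_one
    have hb1 : ⨆ U, |p.1.2.F U| ≤ 1 := Real.iSup_le p.2.2.2.2 zero_le_one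
    calc |latticeConnectedCorr r.ρ β (2 * S + 1) p.1.1.F p.1.2.F n|
        ≤ K * (⨆ U, |p.1.1.F U|) * (⨆ U, |p.1.2.F U|) * Real.exp (-(μ * n)) :=
          hK p.1.1 p.1.2 p.2.1 p.2.2.1 β S n ⟨hβ, hn⟩
      _ ≤ max K 0 * (⨆ U, |p.1.1.F U|) * (⨆ U, |p.1.2.F U|) * Real.exp (-(μ * n)) :=
          mul_le_mul_of_nonneg_right (mul_le_mul_of_nonneg_right
            (mul_le_mul_of_nonneg_right (le_max_left K 0) ha0) hb0) hw
      _ = max K 0 * Real.exp (-(μ * n)) * ((⨆ U, |p.1.1.F U|) * ⨆ U, |p.1.2.F U|) := by ring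
      _ ≤ max K 0 * Real.exp (-(μ * n)) :=
          mul_le_of_le_one_right (mul_nonneg (le_max_right _ _) hw) (mul_le_one₀ ha1 hb0 hb1)
  -- the diagonal lemma: one rate function, β-free constants for the suprema
  obtain ⟨m, hm, hCj⟩ := uniformShape_of_cover (f := f) (a := fun _ => 2)
    (X := fun k => Set.Icc β₁ (β₁ + ((k : ℝ) + 1))) hf2 hcov hunif
  refine ⟨β₁, m, fun _ => 0, hm, fun A B => ?_⟩
  -- read back to the pair `(A, B)` by bilinear rescaling
  obtain ⟨j, hj⟩ := he (A.supp, B.supp)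
  obtain ⟨Cj, hCj⟩ := hCj j
  obtain ⟨A', hA's, hA'1, hA'e⟩ := exists_unit_rescale A
  obtain ⟨B', hB's, hB'1, hB'e⟩ := exists_unit_rescale B
  have ha0 : 0 ≤ ⨆ V, |A.F V| := Real.iSup_nonneg fun V => abs_nonneg _
  have hb0 : 0 ≤ ⨆ V, |B.F V| := Real.iSup_nonneg fun V => abs_nonneg _
  refine ⟨(⨆ V, |A.F V|) * (⨆ V, |B.F V|) * Cj, fun β hβ S n _ hn => ?_⟩
  have hj1 : (e j).1 = A.supp := by rw [hj]
  have hj2 : (e j).2 = B.supp := by rw [hj]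
  have h1 : |latticeConnectedCorr r.ρ β (2 * S + 1) A'.F B'.F n| ≤ f j β S n := by
    rw [hf]
    refine le_ciSup_of_le ?_ ⟨(A', B'), hA's.trans hj1.symm, hB's.trans hj2.symm, hA'1, hB'1⟩
      le_rfl
    refine ⟨2, ?_⟩
    rintro _ ⟨p, rfl⟩
    have := abs_latticeConnectedCorr_le_two_mul r β (2 * S + 1) p.2.2.2.1 p.2.2.2.2 n
    linarith
  have h2 : f j β S n ≤ Cj * Real.exp (-(m β * n)) := (le_abs_self _).trans (hCj β hβ S n hn)
  rw [latticeConnectedCorr_of_rescale r.ρ β (2 * S + 1) hA'e hB'e n, abs_mul, abs_mul,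
    abs_of_nonneg ha0, abs_of_nonneg hb0]
  calc (⨆ V, |A.F V|) * (⨆ V, |B.F V|) * |latticeConnectedCorr r.ρ β (2 * S + 1) A'.F B'.F n|
      ≤ (⨆ V, |A.F V|) * (⨆ V, |B.F V|) * (Cj * Real.exp (-(m β * n))) :=
        mul_le_mul_of_nonneg_left (h1.trans h2) (mul_nonneg ha0 hb0)
    _ = (⨆ V, |A.F V|) * (⨆ V, |B.F V|) * Cj * Real.exp (-(m β * n)) := by ring

end Summit.QuantumFields.YangMills.Theorems.ContinuumLegGivenGap

end
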